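import Mathlib.Tactic

/-!
# Sections of the kernel sheaf by pull-back along an isogeny: the bookkeeping identities

Pure algebraic and finite identities behind the W4 note `ASPLIT-w4rep2g12.md` (pub-hsemireg,
W4, w4-rep-2 gen 12): THEOREM Φ, THEOREM Φ′ (product form), THEOREM Φ_m, and the reflection
step of IDENTITY G′-a (§5.6).

Setting (informal; nothing of it is formalised here): a cell `(n; m, 3m)` with `s = 2m - n = 2`,
so `n = 2m - 2` (`m` odd); `B` a `(1,3)`-polarised abelian surface with period matrix `Z`,
`H = (1/n)·D·ℤ²` the `n²`-point subgroup, `𝒦` the kernel sheaf.  The twelve sections of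
`q^*𝒦 ⊗ N^{m(m-1)} ⊗ P` of THEOREM Φ_m are the pull-backs `σ(x - y) · θ((m-1)x + y)` of
(odd level-`(m-1)` curve through `H`) ⊠ (level-`1` theta) along the isogeny
`α_m (x, y) = (x - y, (m-1)x + y)`; that this lands in the right line bundles is the quadratic-form
identity `quadform_pullback` below (no cross term), and that a level-`6` times a level-`3` theta
expands over level `9` in `x + z/3` and level `2` in `z` is `product_formula_levels` /
`product_formula_linear`.  The finite facts of the "slice" step of THEOREM Φ (cell `(4;3,9)`):
`J₂ ↦ -5·J₂ + c` is a bijection of `ZMod 9`, it shifts the cubic character's argument by a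
multiple of `3`, the cubic character is odd, the weight's quadratic phase is `3`-periodic, and the
pair `(J, K(J,e)) = (J, (2J₁, 8J₂ + 12e))` lies in the key class `(0, 3e)`.  Finally the rank
bookkeeping of the COROLLARY: `3s² = 3m² - n² + t²` and, for `s = 2`, the window defect
`12 - (3m² - n²) = (m - 4)² = t²`, and `c₁(q^*A) = q^* c₁(A)`: `12·m(m-1) = 6m·n`.
Honest framing: identities only; nothing here says HC / HC_CM / HC_AV is proved.
-/

namespace Summit.Ventures.HSemireg.IsogenyPullbackSections

section Ring

variable {R : Type*} [CommRing R]

/-- THEOREM Φ_m, the line-bundle bookkeeping: for `l = m(m-1)`,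
`l·Z[x] + m·Z[y] = (m-1)·Z[x-y] + Z[(m-1)x + y]` — the cross terms cancel, so the pull-back of a
section of `(N^{m-1} P) ⊠ (N P)` along `(x,y) ↦ (x-y, (m-1)x+y)` is a section of `(N^l P') ⊠ N^m`. -/
theorem quadform_pullback (a b c m x₁ x₂ y₁ y₂ : R) :
    m * (m - 1) * (a * x₁ ^ 2 + 2 * b * x₁ * x₂ + c * x₂ ^ 2) +
        m * (a * y₁ ^ 2 + 2 * b * y₁ * y₂ + c * y₂ ^ 2) =
      (m - 1) * (a * (x₁ - y₁) ^ 2 + 2 * b * (x₁ - y₁) * (x₂ - y₂) + c * (x₂ - y₂) ^ 2) +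
        (a * ((m - 1) * x₁ + y₁) ^ 2 + 2 * b * ((m - 1) * x₁ + y₁) * ((m - 1) * x₂ + y₂) +
          c * ((m - 1) * x₂ + y₂) ^ 2) := by
  ring

/-- The cell `(4;3,9)` instance (`m = 3`): `6·Z[x] + 3·Z[y] = 2·Z[x-y] + Z[2x+y]`. -/
theorem quadform_pullback_439 (a b c x₁ x₂ y₁ y₂ : R) :
    6 * (a * x₁ ^ 2 + 2 * b * x₁ * x₂ + c * x₂ ^ 2) +
        3 * (a * y₁ ^ 2 + 2 * b * y₁ * y₂ + c * y₂ ^ 2) =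
      2 * (a * (x₁ - y₁) ^ 2 + 2 * b * (x₁ - y₁) * (x₂ - y₂) + c * (x₂ - y₂) ^ 2) +
        (a * (2 * x₁ + y₁) ^ 2 + 2 * b * (2 * x₁ + y₁) * (2 * x₂ + y₂) +
          c * (2 * x₂ + y₂) ^ 2) := by
  ring

/-- The product formula used in THEOREM Φ, step (Φ1), quadratic part: with `q = p - p'` and
`3r = 2p + p'`, `6·Z[p] + 3·Z[p'] = 9·Z[r] + 2·Z[q]`, written without division as
`6·Z[p] + 3·Z[p'] = Z[2p + p'] + 2·Z[p - p']`. -/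
theorem product_formula_levels (a b c p₁ p₂ p₁' p₂' : R) :
    6 * (a * p₁ ^ 2 + 2 * b * p₁ * p₂ + c * p₂ ^ 2) +
        3 * (a * p₁' ^ 2 + 2 * b * p₁' * p₂' + c * p₂' ^ 2) =
      (a * (2 * p₁ + p₁') ^ 2 + 2 * b * (2 * p₁ + p₁') * (2 * p₂ + p₂') +
          c * (2 * p₂ + p₂') ^ 2) +
        2 * (a * (p₁ - p₁') ^ 2 + 2 * b * (p₁ - p₁') * (p₂ - p₂') + c * (p₂ - p₂') ^ 2) := by
  ring

/-- The product formula, linear part (one coordinate; multiply by `3` to clear the denominator):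
`3·(6·p·x + 3·p'·(x + z)) = 3·(2p + p')·(3x + z) - 6·(p - p')·z`, i.e.
`6px + 3p'(x+z) = 9r(x + z/3) - 2qz` with `3r = 2p + p'`, `q = p - p'`. -/
theorem product_formula_linear (p p' x z : R) :
    3 * (6 * p * x + 3 * p' * (x + z)) = 3 * (2 * p + p') * (3 * x + z) - 6 * (p - p') * z := by
  ring

/-- The window bookkeeping `3s² = 3m² - n² + t²` for `s = 2m - n`, `t = 2n - 3m`
(rank of the kernel sheaf = expected rank + defect). -/
theorem rank_plus_defect (m n : R) :
    3 * (2 * m - n) ^ 2 = 3 * m ^ 2 - n ^ 2 + (2 * n - 3 * m) ^ 2 := by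
  ring

/-- The COROLLARY's defect for the `s = 2` family `n = 2m - 2`: twelve independent sections give
`corank(ev) ≥ 12 - (3m² - n²) = (m - 4)²`, and `m - 4 = t = 2n - 3m`. -/
theorem window_defect_s2 (m : R) :
    (12 : R) - (3 * m ^ 2 - (2 * m - 2) ^ 2) = (m - 4) ^ 2 ∧ 2 * (2 * m - 2) - 3 * m = m - 4 := by
  constructor <;> ring

/-- First Chern class bookkeeping for `q^*A`: twelve line bundles of level `-m(m-1)` upstairs
against `c₁(A) = -3sm·ν̄ = -6m·ν̄` downstairs and `q^*ν̄ = n·ν`, `n = 2m - 2`: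
`12·m(m-1) = 6m·(2m-2)`. -/
theorem chern_bookkeeping_s2 (m : R) : 12 * (m * (m - 1)) = 6 * m * (2 * m - 2) := by
  ring

/-- The weight's quadratic phase `x(2x+1)` is `3`-periodic modulo `3` (so `ω_{e,β}(J)` depends on
`J₂ - e` only through its class mod `3`): `(x+3)(2(x+3)+1) - x(2x+1) = 3(4x+7)`. -/
theorem phase_three_periodic (x : R) :
    (x + 3) * (2 * (x + 3) + 1) - x * (2 * x + 1) = 3 * (4 * x + 7) := by
  ring


/-- IDENTITY G′-a, the key step (note §5.6): the reflection `(x, y) ↦ ((x+y)/2, (3x-y)/2)`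
is an isometry of the binary form `x² + y²/3` — written over a field with `2, 3` invertible as
`4·3·(form at the image) = 4·3·(form)` to stay division-free:
`3(x+y)² + (3x-y)² = 12x² + 4y²`. -/
theorem reflection_isometry (x y : R) :
    3 * (x + y) ^ 2 + (3 * x - y) ^ 2 = 12 * x ^ 2 + 4 * y ^ 2 := by
  ring

/-- The same reflection fixes the linear functional `x + y/3` (times `6`):
`3(x+y) + (3x-y) = 6x + 2y`. -/
theorem reflection_fixes_functional (x y : R) :
    3 * (x + y) + (3 * x - y) = 6 * x + 2 * y := by
  ring

/-- The reflection is an involution: with `(x₁, y₁) = ((x+y)/2, (3x-y)/2)`, applying it again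
gives `((x₁+y₁)/2, (3x₁-y₁)/2) = (x, y)`; division-free: `(x+y) + (3x-y) = 4x` and
`3(x+y) - (3x-y) = 4y`. -/
theorem reflection_involution (x y : R) :
    (x + y) + (3 * x - y) = 4 * x ∧ 3 * (x + y) - (3 * x - y) = 4 * y := by
  constructor <;> ring

end Ring

section Finite

/-- The cubic character `χ₃` on `ZMod 3` (Legendre symbol mod `3`, written as an `if` cascade
valued in `ℤ`) is odd. -/
theorem chi3_odd : ∀ x : ZMod 3,
    (if -x = 0 then (0 : ℤ) else if -x = 1 then 1 else -1) =
      -(if x = 0 then (0 : ℤ) else if x = 1 then 1 else -1) := by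
  decide

/-- THEOREM Φ, step (Φ2): on a slice, `J₂ ↦ L = -5·J₂ + c` is a bijection of `ZMod 9`
(for every constant `c`; `-5` is a unit mod `9`). -/
theorem slice_map_bijective : ∀ c : ZMod 9, Function.Bijective fun J : ZMod 9 => -5 * J + c := by
  decide

/-- THEOREM Φ, step (Φ2): the slice map shifts the character's argument by a multiple of `3`:
`L - (J₂ - e) = (-5J₂ + 2e + 6ρ) - (J₂ - e) = 3·(-2J₂ + e + 2ρ)`, so `χ₃(e - J₂) = χ₃(-L)`. -/
theorem slice_map_mod3 (J e ρ : ℤ) :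
    (-5 * J + 2 * e + 6 * ρ) - (J - e) = 3 * (-2 * J + e + 2 * ρ) := by
  ring

/-- THEOREM Φ: the support pair `(J, K(J,e))` with `K = (2J₁, 8J₂ + 12e)` lies in the key class
`(J₁ + K₁, J₂ + K₂) ≡ (0, 3e)` modulo `(3, 9)`. -/
theorem support_key_class (J₁ J₂ e : ℤ) :
    (3 : ℤ) ∣ J₁ + 2 * J₁ ∧ (9 : ℤ) ∣ J₂ + (8 * J₂ + 12 * e) - 3 * e := by
  exact ⟨⟨J₁, by ring⟩, ⟨J₂ + e, by ring⟩⟩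

/-- LEMMA P_ν bookkeeping: for the upper characteristic `a = (0, 1/3)` and a half-period
`h = (i, 3j)/(2ν)` of level `ν` (so `ν·h = (i, 3j)/2` and `2ν·h = D·(i,j)` with
`D = diag(1,3)`), the phase exponent `aᵀ·D·(i, j) = (1/3)·(3j)` is the INTEGER `j`, and for
`β ∈ {0, 1/2}` the lower shift `2β` is an integer: here as the divisibilities `3 ∣ 3j` and
`2 ∣ 2b`. -/
theorem parity_bookkeeping (j b : ℤ) : (3 : ℤ) ∣ 3 * j ∧ (2 : ℤ) ∣ 2 * b := by
  exact ⟨⟨j, by ring⟩, ⟨b, by ring⟩⟩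


/-- IDENTITY G′-a, the index bookkeeping: for integers `n ≡ n'` (mod 2) the reflected indices
`(n + n')/2` and `(3n - n')/2` are integers, and their sum `2n` is even while the second one
shifted by `1` makes the pair land in the other parity class: here as the divisibilities
`2 ∣ n + n'`, `2 ∣ 3n - n'` (given `2 ∣ n - n'`) and `(n+n') + (3n-n') = 4n`. -/
theorem parity_swap (n n' : ℤ) (h : (2 : ℤ) ∣ n - n') :
    (2 : ℤ) ∣ n + n' ∧ (2 : ℤ) ∣ 3 * n - n' ∧ (n + n') + (3 * n - n') = 4 * n := by
  obtain ⟨k, hk⟩ := h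
  refine ⟨⟨n' + k, by linarith⟩, ⟨n + k, by linarith⟩, by ring⟩

/-- IDENTITY G′-a, the characteristic bookkeeping: the reflection carries the upper
characteristic `2/3` (second coordinate of `a = (0, 2/3)`) to `1/3` (`a' = a/2`) and `3·(2/3)/2`
is the integer `1`: `(2/3)/2 = 1/3` and `3·(2/3)/2 = 1`, over `ℚ`. -/
theorem characteristic_halves : ((2 : ℚ) / 3) / 2 = 1 / 3 ∧ 3 * ((2 : ℚ) / 3) / 2 = 1 := by
  norm_num

/-- Census bookkeeping for a window cell `(n; m, 3m)` with `n = 2m - 2` and `t = m - 4`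
(THEOREM K_m): the generic rank `n² - t²` of the evaluation map equals `3m² - 12`, i.e. the
kernel has rank `12 = 3·2²`. -/
theorem window_rank_twelve (m : ℤ) : (2 * m - 2) ^ 2 - (m - 4) ^ 2 = 3 * m ^ 2 - 12 := by
  ring

/-- Census bookkeeping below the line (CONJECTURE S ∕ THEOREM S♮): with `s = 2m - n` and
`t = 2n - 3m`, the rank `3m² - n²` of the kernel plus the rank `t²` of the sub-bundle `B` is the
rank `3s²` of the semi-homogeneous middle term `A`. -/
theorem middle_term_rank (n m : ℤ) :
    3 * m ^ 2 - n ^ 2 + (2 * n - 3 * m) ^ 2 = 3 * (2 * m - n) ^ 2 := by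
  ring

/-- THEOREM S♮ ∕ COROLLARY TR for the cell `(4;3,9)`: the two dimension laws `D(k) = (3(2k-3))²`
(below `k*`) and `D♭(k) = 33k² - 72k - 27` (beyond `k*`) differ by `3(k-6)²`, so they TOUCH at
the critical level `k* = 6` (where both equal `729`), and nowhere else. -/
theorem kstar_tangency_439 (k : ℤ) :
    (3 * (2 * k - 3)) ^ 2 - (33 * k ^ 2 - 72 * k - 27) = 3 * (k - 6) ^ 2 := by
  ring

/-- THEOREM S♮, the critical value: `D(6) = D♭(6) = 729` for `(4;3,9)`, and `dim R₆ = 730` is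
one more. -/
theorem kstar_value_439 :
    (3 * (2 * 6 - 3) : ℤ) ^ 2 = 729 ∧ (33 * 6 ^ 2 - 72 * 6 - 27 : ℤ) = 729 ∧ (729 : ℤ) + 1 = 730 := by
  norm_num

/-- THEOREM G′_m bookkeeping (Euler characteristics): with `m = ν + 1`,
`χ(⊕_β N P_β) - χ(N^m) + |H_ν| = 12 - 3m² + 4ν² = (ν - 3)² = χ(ψ_* Θ_X^(3-ν))`. -/
theorem relation_sheaf_chi (ν : ℤ) : 12 - 3 * (ν + 1) ^ 2 + 4 * ν ^ 2 = (ν - 3) ^ 2 := by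
  ring

end Finite

end Summit.Ventures.HSemireg.IsogenyPullbackSections
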